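import Summits.HodgeConjecture.CorCM.TwoGroupHalfSubgroup
import Summits.HodgeConjecture.CorCM.TwoGroupExtraspecialTable
import HarnessLib

/-!
# Normal forms in the centraliser of an involution with two conjugates (`|G| = 32`)

COR-CM (cell `pub-hodgecm2`), binder seat b04 (gen 37), count-neutral own lane «Galois-CM-type classification».  KERNEL ONLY:
theorems; no definition, no named fact, no `sorry`.  Pure group theory for «case A» of the ORDER-`32` BASE programme
(A7-JUNCTION gen-37 addendum).  `t` an involution with `x t x⁻¹ = t c` and all conjugates in `{t, tc}`: its centraliser
`M = C(t)` has index `2` (`index_centralizer_eq_two_of_conj`), so an injective family of sixteen elements of `M` enumerates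
`M` (`exists_eq_of_injective_sixteen`).  Three families: `aⁱ tʲ cᵏ` for `a ∈ M` of order `4` with `a² ∉ N = ⟨t, c⟩`
(`exists_word_four`), `aⁱ tʲ` for `a ∈ M` of order `8` (`exists_word_eight`), and `tᵖ c^q aⁱ bʲ` for `a ∈ M ∖ N`,
`b ∈ M ∖ N⟨a⟩` with `a² ∈ N` (`exists_word_pair`).

## References

* [Rotman1995] J. J. Rotman, *An Introduction to the Theory of Groups*, 4th ed., GTM 148, Ch. 4 (Ex. 4.4) and Ch. 5.
-/

namespace Summit.HodgeConjecture.CorCM.GaloisModels.CaseA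

open Summit.HodgeConjecture.CorCM.GaloisModels.FrattiniTwo (invol_pow_add)
open Summit.HodgeConjecture.CorCM.GaloisTableLaws (zmod2_cases pow_eq_pow_of_mod_eq)

variable {G : Type*} [Group G]

/-! ## §1 Counting -/

/-- In a group of order `32`, an injective map from a `16`-element type into a subgroup of index `2` is onto. [folklore] -/
theorem exists_eq_of_injective_sixteen [Finite G] (hcard : Nat.card G = 32) {H : Subgroup G} (hidx : H.index = 2)
    {X : Type*} [Finite X] (hX : Nat.card X = 16) (f : X → G) (hf : Function.Injective f) (hfH : ∀ p, f p ∈ H)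
    (w : G) (hw : w ∈ H) : ∃ p, f p = w := by
  have hH : Nat.card H = 16 := by
    have := H.card_mul_index
    rw [hidx, hcard] at this
    omega
  let f' : X → H := fun p => ⟨f p, hfH p⟩
  have hinj : Function.Injective f' := fun p q h => hf (congrArg Subtype.val h)
  have hbij : Function.Bijective f' := hinj.bijective_of_nat_card_le (by rw [hH, hX])
  obtain ⟨p, hp⟩ := hbij.2 ⟨w, hw⟩
  exact ⟨p, congrArg Subtype.val hp⟩

/-- **The centraliser of an involution with conjugates `{t, tc}` has index `2`** (`c ≠ 1`, some `x t x⁻¹ = tc`).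
[cite: Rotman1995, Ch. 4 Ex. 4.4] -/
theorem index_centralizer_eq_two_of_conj {t c x : G} (hc1 : c ≠ 1) (hxt : x * t * x⁻¹ = t * c)
    (hconj : ∀ g : G, g * t * g⁻¹ = t ∨ g * t * g⁻¹ = t * c) :
    (Subgroup.centralizer ({t} : Set G)).index = 2 := by
  rw [Subgroup.index_eq_two_iff]
  refine ⟨x, fun b => ?_⟩
  -- `(b x) t (b x)⁻¹ = (b t b⁻¹) (b c b⁻¹)`
  have hbx : b * x * t * (b * x)⁻¹ = (b * t * b⁻¹) * (b * c * b⁻¹) := by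
    rw [show b * x * t * (b * x)⁻¹ = b * (x * t * x⁻¹) * b⁻¹ by group, hxt]; group
  have hcb : b * c * b⁻¹ ≠ 1 := fun h => hc1 (by
    have := congrArg (fun y => b⁻¹ * y * b) h
    simpa [mul_assoc] using this)
  by_cases hb : b * t = t * b
  · right
    refine ⟨Subgroup.mem_centralizer_singleton_iff.2 hb, fun h => hcb ?_⟩
    have h1 : b * x * t * (b * x)⁻¹ = t := by rw [Subgroup.mem_centralizer_singleton_iff.1 h]; group
    rw [hbx, show b * t * b⁻¹ = t by rw [hb]; group] at h1
    exact mul_left_cancel (h1.trans (mul_one t).symm)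
  · left
    have hbt : b * t * b⁻¹ = t * c := (hconj b).resolve_left fun h => hb (mul_inv_eq_iff_eq_mul.1 h)
    refine ⟨Subgroup.mem_centralizer_singleton_iff.2 ?_, fun h => hb (Subgroup.mem_centralizer_singleton_iff.1 h)⟩
    rcases hconj (b * x) with h | h
    · exact mul_inv_eq_iff_eq_mul.1 h
    · exfalso
      rw [hbx, hbt] at h
      exact hcb (mul_left_cancel (h.trans (mul_one _).symm))

/-! ## §2 Words in two commuting involutions -/

/-- `t, c` involutions with `t ∉ {1, c}`, `c ≠ 1`: `tʲ cᵏ = 1 ⟹ j = k = 0`. [folklore] -/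
theorem invol_word_eq_one {t c : G} (hcc : c * c = 1) (ht1 : t ≠ 1) (htc : t ≠ c) (hc1 : c ≠ 1) {j k : ZMod 2}
    (h : t ^ j.val * c ^ k.val = 1) : j = 0 ∧ k = 0 := by
  have hv1 : (1 : ZMod 2).val = 1 := rfl
  rcases zmod2_cases j with rfl | rfl <;> rcases zmod2_cases k with rfl | rfl
  · exact ⟨rfl, rfl⟩
  · rw [ZMod.val_zero, hv1, pow_zero, pow_one, one_mul] at h; exact (hc1 h).elim
  · rw [ZMod.val_zero, hv1, pow_zero, pow_one, mul_one] at h; exact (ht1 h).elim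
  · rw [hv1, pow_one, pow_one, mul_eq_one_iff_eq_inv, inv_eq_of_mul_eq_one_right hcc] at h; exact (htc h).elim

/-- Products of words `tʲ cᵏ` (commuting involutions). [folklore] -/
theorem invol_word_mul {t c : G} (htt : t * t = 1) (hcc : c * c = 1) (htc : t * c = c * t) (j k j' k' : ZMod 2) :
    t ^ j.val * c ^ k.val * (t ^ j'.val * c ^ k'.val) = t ^ (j + j').val * c ^ (k + k').val := by
  rw [invol_pow_add htt, invol_pow_add hcc, mul_assoc, ← mul_assoc (c ^ k.val),
    ((show Commute t c from htc).symm.pow_pow k.val j'.val).eq]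
  group

/-- `tʲ cᵏ = t^{j'} c^{k'} ⟹ (j, k) = (j', k')` for involutions `t ∉ {1, c}`, `c ≠ 1`, `tc = ct`. [folklore] -/
theorem invol_word_injective {t c : G} (htt : t * t = 1) (hcc : c * c = 1) (htc : t * c = c * t) (ht1 : t ≠ 1)
    (htne : t ≠ c) (hc1 : c ≠ 1) {j k j' k' : ZMod 2} (h : t ^ j.val * c ^ k.val = t ^ j'.val * c ^ k'.val) :
    j = j' ∧ k = k' := by
  have h1 : t ^ j.val * c ^ k.val * (t ^ j'.val * c ^ k'.val) = 1 := by
    rw [h, invol_word_mul htt hcc htc]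
    have h2 : ∀ z : ZMod 2, (z + z).val = 0 := by decide
    rw [h2, h2, pow_zero, pow_zero, mul_one]
  rw [invol_word_mul htt hcc htc] at h1
  obtain ⟨hj, hk⟩ := invol_word_eq_one hcc ht1 htne hc1 h1
  have h3 : ∀ z w : ZMod 2, z + w = 0 → z = w := by decide
  exact ⟨h3 _ _ hj, h3 _ _ hk⟩

/-! ## §3 Injective word maps -/

/-- Powers indexed by `ℤ/4`: `a⁴ = 1 ⟹ a^{(i+i').val} = a^{i.val} a^{i'.val}`. [folklore] -/
theorem pow_val_add_four {a : G} (ha4 : a ^ 4 = 1) (i i' : ZMod 4) : a ^ (i + i').val = a ^ i.val * a ^ i'.val := by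
  rw [← pow_add]
  exact pow_eq_pow_of_mod_eq a ha4 (by rw [ZMod.val_add]; omega)

/-- **`(i, j, k) ↦ aⁱ tʲ cᵏ` is injective on `ℤ/4 × 𝔽₂ × 𝔽₂`** when `orderOf a = 4`, `t, c` are commuting involutions with
`t ∉ {1, c}`, `c ≠ 1`, `a` commutes with `t` and `c`, and `a² ∉ {t, c, tc}`. [folklore] -/
theorem words_injective_four {a t c : G} (ha : orderOf a = 4) (htt : t * t = 1) (hcc : c * c = 1) (htc : t * c = c * t)
    (ht1 : t ≠ 1) (htne : t ≠ c) (hc1 : c ≠ 1) (hat : a * t = t * a) (hac : a * c = c * a)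
    (hsq : a * a ≠ t ∧ a * a ≠ c ∧ a * a ≠ t * c) :
    Function.Injective fun p : ZMod 4 × ZMod 2 × ZMod 2 => a ^ p.1.val * t ^ p.2.1.val * c ^ p.2.2.val := by
  classical
  have ha4 : a ^ 4 = 1 := by rw [← ha]; exact pow_orderOf_eq_one a
  have hv1 : (1 : ZMod 2).val = 1 := rfl
  -- `aⁱ = tʲ cᵏ ⟹ i = 0`
  have hN : ∀ (i : ZMod 4) (j k : ZMod 2), a ^ i.val = t ^ j.val * c ^ k.val → i = 0 := by
    intro i j k h
    have hsq1 : a ^ i.val * a ^ i.val = 1 := by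
      rw [h, invol_word_mul htt hcc htc]
      have h2 : ∀ z : ZMod 2, (z + z).val = 0 := by decide
      rw [h2, h2, pow_zero, pow_zero, mul_one]
    have hd : orderOf a ∣ 2 * i.val := orderOf_dvd_of_pow_eq_one (by rw [mul_comm, pow_mul, pow_two, hsq1])
    rw [ha] at hd
    have hi : i.val = 0 ∨ i.val = 2 := by have := ZMod.val_lt i; omega
    rcases hi with hi | hi
    · exact (ZMod.val_eq_zero i).1 hi
    · exfalso
      rw [hi, pow_two] at h
      rcases zmod2_cases j with rfl | rfl <;> rcases zmod2_cases k with rfl | rfl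
      · simp only [ZMod.val_zero, pow_zero, mul_one] at h
        have := orderOf_dvd_of_pow_eq_one (show a ^ 2 = 1 by rw [pow_two, h])
        rw [ha] at this; omega
      · simp only [ZMod.val_zero, hv1, pow_zero, pow_one, one_mul] at h; exact hsq.2.1 h
      · simp only [ZMod.val_zero, hv1, pow_zero, pow_one, mul_one] at h; exact hsq.1 h
      · simp only [hv1, pow_one] at h; exact hsq.2.2 h
  rintro ⟨i, j, k⟩ ⟨i', j', k'⟩ h
  simp only at h
  -- move everything to one side: `a^{(i - i').val} = t^{(j'+j)} c^{(k'+k)}`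
  have hcomm : ∀ (n : ℕ) (j k : ZMod 2), a ^ n * (t ^ j.val * c ^ k.val) = t ^ j.val * c ^ k.val * a ^ n := fun n j k =>
    (((show Commute a t from hat).pow_pow n j.val).mul_right ((show Commute a c from hac).pow_pow n k.val)).eq
  have hzz : ∀ z : ZMod 2, (z + z).val = 0 := by decide
  have h1 : a ^ (i - i').val = t ^ (j' + j).val * c ^ (k' + k).val := by
    have h2 : a ^ i.val = a ^ i'.val * (t ^ j'.val * c ^ k'.val * (t ^ j.val * c ^ k.val)) := by
      calc a ^ i.val = a ^ i.val * (t ^ j.val * c ^ k.val * (t ^ j.val * c ^ k.val)) := by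
            rw [invol_word_mul htt hcc htc, hzz, hzz, pow_zero, pow_zero, mul_one, mul_one]
        _ = a ^ i.val * t ^ j.val * c ^ k.val * (t ^ j.val * c ^ k.val) := by group
        _ = a ^ i'.val * t ^ j'.val * c ^ k'.val * (t ^ j.val * c ^ k.val) := by rw [h]
        _ = a ^ i'.val * (t ^ j'.val * c ^ k'.val * (t ^ j.val * c ^ k.val)) := by group
    rw [invol_word_mul htt hcc htc] at h2
    have h4 : a ^ (i - i').val = a ^ i.val * a ^ (-i').val := by rw [sub_eq_add_neg, pow_val_add_four ha4]
    have h5 : a ^ i'.val * a ^ (-i').val = 1 := by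
      rw [← pow_val_add_four ha4, add_neg_cancel, ZMod.val_zero, pow_zero]
    have hW := hcomm (-i').val (j' + j) (k' + k)
    calc a ^ (i - i').val = a ^ i.val * a ^ (-i').val := h4
      _ = a ^ i'.val * (t ^ (j' + j).val * c ^ (k' + k).val) * a ^ (-i').val := by rw [h2]
      _ = a ^ i'.val * (a ^ (-i').val * (t ^ (j' + j).val * c ^ (k' + k).val)) := by rw [hW]; group
      _ = (a ^ i'.val * a ^ (-i').val) * (t ^ (j' + j).val * c ^ (k' + k).val) := by group
      _ = t ^ (j' + j).val * c ^ (k' + k).val := by rw [h5, one_mul]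
  have hi : i = i' := by have := hN _ _ _ h1; rwa [sub_eq_zero] at this
  subst hi
  have h6 : t ^ j.val * c ^ k.val = t ^ j'.val * c ^ k'.val := by
    have := h
    rw [mul_assoc, mul_assoc] at this
    exact mul_left_cancel this
  obtain ⟨hj, hk⟩ := invol_word_injective htt hcc htc ht1 htne hc1 h6
  subst hj; subst hk; rfl

/-- **`(p, q, i, j) ↦ tᵖ c^q aⁱ bʲ` is injective on `𝔽₂⁴`** when `t, c` are commuting involutions with `t ∉ {1, c}`, `c ≠ 1`,
`a` commutes with `t, c`, `a² = t^{α₁} c^{α₂}`, `a ∉ {tᵖ c^q}` and `b ∉ {tᵖ c^q aⁱ}`. [folklore] -/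
theorem words_injective_pair {a b t c : G} (htt : t * t = 1) (hcc : c * c = 1) (htc : t * c = c * t) (ht1 : t ≠ 1)
    (htne : t ≠ c) (hc1 : c ≠ 1) (hat : a * t = t * a) (hac : a * c = c * a) {α₁ α₂ : ZMod 2}
    (haa : a * a = t ^ α₁.val * c ^ α₂.val) (ha : ∀ p q : ZMod 2, a ≠ t ^ p.val * c ^ q.val)
    (hb : ∀ p q i : ZMod 2, b ≠ t ^ p.val * (c ^ q.val * a ^ i.val)) :
    Function.Injective fun P : ZMod 2 × ZMod 2 × ZMod 2 × ZMod 2 =>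
      t ^ P.1.val * c ^ P.2.1.val * a ^ P.2.2.1.val * b ^ P.2.2.2.val := by
  classical
  have hv1 : (1 : ZMod 2).val = 1 := rfl
  -- three-letter words `tᵖ c^q aⁱ` are closed under products and inverses
  have hcomm : ∀ (i : ZMod 2) (p q : ZMod 2), a ^ i.val * (t ^ p.val * c ^ q.val) = t ^ p.val * c ^ q.val * a ^ i.val :=
    fun i p q => (((show Commute a t from hat).pow_pow i.val p.val).mul_right
      ((show Commute a c from hac).pow_pow i.val q.val)).eq
  have haa' : ∀ i i' : ZMod 2, a ^ i.val * a ^ i'.val = t ^ (α₁ * (i * i')).val * c ^ (α₂ * (i * i')).val * a ^ (i + i').val := by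
    intro i i'
    rcases zmod2_cases i with rfl | rfl <;> rcases zmod2_cases i' with rfl | rfl <;>
      simp only [ZMod.val_zero, hv1, pow_zero, pow_one, one_mul, mul_one, mul_zero, zero_add, add_zero]
    rw [haa, show ((1 : ZMod 2) + 1).val = 0 from rfl, pow_zero, mul_one]
  have hmul3 : ∀ p q i p' q' i' : ZMod 2, t ^ p.val * c ^ q.val * a ^ i.val * (t ^ p'.val * c ^ q'.val * a ^ i'.val) =
      t ^ (p + p' + α₁ * (i * i')).val * c ^ (q + q' + α₂ * (i * i')).val * a ^ (i + i').val := by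
    intro p q i p' q' i'
    calc t ^ p.val * c ^ q.val * a ^ i.val * (t ^ p'.val * c ^ q'.val * a ^ i'.val)
        = t ^ p.val * c ^ q.val * (a ^ i.val * (t ^ p'.val * c ^ q'.val)) * a ^ i'.val := by group
      _ = t ^ p.val * c ^ q.val * (t ^ p'.val * c ^ q'.val) * (a ^ i.val * a ^ i'.val) := by rw [hcomm]; group
      _ = t ^ (p + p').val * c ^ (q + q').val * (t ^ (α₁ * (i * i')).val * c ^ (α₂ * (i * i')).val) * a ^ (i + i').val := by
          rw [invol_word_mul htt hcc htc, haa']; group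
      _ = t ^ (p + p' + α₁ * (i * i')).val * c ^ (q + q' + α₂ * (i * i')).val * a ^ (i + i').val := by
          rw [invol_word_mul htt hcc htc]
  have hinv3 : ∀ p q i : ZMod 2, (t ^ p.val * c ^ q.val * a ^ i.val)⁻¹ =
      t ^ (p + α₁ * (i * i)).val * c ^ (q + α₂ * (i * i)).val * a ^ i.val := by
    intro p q i
    rw [inv_eq_iff_mul_eq_one, hmul3]
    have e1 : ∀ z w v : ZMod 2, z + (z + w * (v * v)) + w * (v * v) = 0 := by decide
    have h3 : ∀ z : ZMod 2, (z + z).val = 0 := by decide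
    rw [e1, e1, ZMod.val_zero, pow_zero, pow_zero, h3, pow_zero, mul_one, mul_one]
  rintro ⟨p, q, i, j⟩ ⟨p', q', i', j'⟩ h
  simp only at h
  -- equal `j`: otherwise `b` is a three-letter word
  have hjj : j = j' := by
    rcases zmod2_cases j with rfl | rfl <;> rcases zmod2_cases j' with rfl | rfl
    · rfl
    · exfalso
      rw [ZMod.val_zero, hv1, pow_zero, pow_one, mul_one] at h
      have hb' : b = (t ^ p'.val * c ^ q'.val * a ^ i'.val)⁻¹ * (t ^ p.val * c ^ q.val * a ^ i.val) :=
        eq_inv_mul_of_mul_eq h.symm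
      rw [hinv3, hmul3, mul_assoc] at hb'
      exact hb _ _ _ hb'
    · exfalso
      rw [ZMod.val_zero, hv1, pow_zero, pow_one, mul_one] at h
      have hb' : b = (t ^ p.val * c ^ q.val * a ^ i.val)⁻¹ * (t ^ p'.val * c ^ q'.val * a ^ i'.val) :=
        eq_inv_mul_of_mul_eq h
      rw [hinv3, hmul3, mul_assoc] at hb'
      exact hb _ _ _ hb'
    · rfl
  subst hjj
  have hM : t ^ p.val * c ^ q.val * a ^ i.val = t ^ p'.val * c ^ q'.val * a ^ i'.val := mul_right_cancel h
  -- equal `i`: otherwise `a` is a two-letter word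
  have hii : i = i' := by
    rcases zmod2_cases i with rfl | rfl <;> rcases zmod2_cases i' with rfl | rfl
    · rfl
    · exfalso
      rw [ZMod.val_zero, hv1, pow_zero, pow_one, mul_one] at hM
      have ha' : a = (t ^ p'.val * c ^ q'.val)⁻¹ * (t ^ p.val * c ^ q.val) := eq_inv_mul_of_mul_eq hM.symm
      rw [show (t ^ p'.val * c ^ q'.val)⁻¹ = t ^ p'.val * c ^ q'.val by
        rw [inv_eq_iff_mul_eq_one, invol_word_mul htt hcc htc]
        have h3 : ∀ z : ZMod 2, (z + z).val = 0 := by decide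
        rw [h3, h3, pow_zero, pow_zero, mul_one], invol_word_mul htt hcc htc] at ha'
      exact ha _ _ ha'
    · exfalso
      rw [ZMod.val_zero, hv1, pow_zero, pow_one, mul_one] at hM
      have ha' : a = (t ^ p.val * c ^ q.val)⁻¹ * (t ^ p'.val * c ^ q'.val) := eq_inv_mul_of_mul_eq hM
      rw [show (t ^ p.val * c ^ q.val)⁻¹ = t ^ p.val * c ^ q.val by
        rw [inv_eq_iff_mul_eq_one, invol_word_mul htt hcc htc]
        have h3 : ∀ z : ZMod 2, (z + z).val = 0 := by decide
        rw [h3, h3, pow_zero, pow_zero, mul_one], invol_word_mul htt hcc htc] at ha'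
      exact ha _ _ ha'
    · rfl
  subst hii
  obtain ⟨hp, hq⟩ := invol_word_injective htt hcc htc ht1 htne hc1 (mul_right_cancel hM)
  subst hp; subst hq; rfl

/-! ## §4 Enumerations of `C(t)` -/

variable [Finite G]

/-- **`C(t) = ⟨a⟩ × ⟨t⟩`** for `a ∈ C(t)` of order `8` with `t ≠ a⁴`: every `m` commuting with `t` is `aⁱ tʲ` (`i < 8`, `j < 2`).
[cite: Rotman1995, Ch. 4 Ex. 4.4] -/
theorem exists_word_eight (hcard : Nat.card G = 32) {t c x a : G} (hc1 : c ≠ 1) (hxt : x * t * x⁻¹ = t * c)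
    (hconj : ∀ g : G, g * t * g⁻¹ = t ∨ g * t * g⁻¹ = t * c) (htt : t * t = 1) (ht1 : t ≠ 1) (ha : orderOf a = 8)
    (ht4 : t ≠ a ^ 4) (hat : a * t = t * a) (m : G) (hm : m * t = t * m) :
    ∃ i j : ℕ, i < 8 ∧ j < 2 ∧ m = a ^ i * t ^ j := by
  classical
  have hidx := index_centralizer_eq_two_of_conj hc1 hxt hconj
  have hta : t ∉ Subgroup.zpowers a := not_mem_zpowers_of_involution ha htt ht1 ht4
  obtain ⟨⟨i, j⟩, hij⟩ := exists_eq_of_injective_sixteen hcard hidx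
    (by simp) _ (words_injective ha hta)
    (fun p => Subgroup.mem_centralizer_singleton_iff.2
      ((((show Commute t a from hat.symm).pow_right _).mul_right ((Commute.refl t).pow_right _)).eq).symm)
    m (Subgroup.mem_centralizer_singleton_iff.2 hm)
  exact ⟨i.val, j.val, ZMod.val_lt i, ZMod.val_lt j, hij.symm⟩

/-- **`C(t) = ⟨a⟩ × ⟨t⟩ × ⟨c⟩`** for `a ∈ C(t)` of order `4` with `a² ∉ {t, c, tc}` (`c` central): every `m` commuting with
`t` is `aⁱ tʲ cᵏ`. [cite: Rotman1995, Ch. 4 Ex. 4.4] -/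
theorem exists_word_four (hcard : Nat.card G = 32) {t c x a : G} (hcc : c * c = 1) (hc1 : c ≠ 1)
    (hcen : ∀ g : G, c * g = g * c) (hxt : x * t * x⁻¹ = t * c)
    (hconj : ∀ g : G, g * t * g⁻¹ = t ∨ g * t * g⁻¹ = t * c) (htt : t * t = 1) (ht1 : t ≠ 1) (htne : t ≠ c)
    (ha : orderOf a = 4) (hat : a * t = t * a) (hsq : a * a ≠ t ∧ a * a ≠ c ∧ a * a ≠ t * c) (m : G)
    (hm : m * t = t * m) : ∃ (i : ZMod 4) (j k : ZMod 2), m = a ^ i.val * t ^ j.val * c ^ k.val := by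
  classical
  have hidx := index_centralizer_eq_two_of_conj hc1 hxt hconj
  obtain ⟨⟨i, j, k⟩, hijk⟩ := exists_eq_of_injective_sixteen hcard hidx
    (by simp) _
    (words_injective_four ha htt hcc (hcen t).symm ht1 htne hc1 hat (hcen a).symm hsq)
    (fun p => Subgroup.mem_centralizer_singleton_iff.2
      (((((show Commute t a from hat.symm).pow_right _).mul_right ((Commute.refl t).pow_right _)).mul_right
        ((show Commute t c from (hcen t).symm).pow_right _)).eq).symm)
    m (Subgroup.mem_centralizer_singleton_iff.2 hm)
  exact ⟨i, j, k, hijk.symm⟩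

/-- **`C(t) = N{1, a, b, ab}`**, `N = ⟨t, c⟩`: for `a, b ∈ C(t)` with `a² ∈ N`, `a ∉ N`, `b ∉ N⟨a⟩`, every `m` commuting with
`t` is `tᵖ c^q aⁱ bʲ`. [cite: Rotman1995, Ch. 4 Ex. 4.4] -/
theorem exists_word_pair (hcard : Nat.card G = 32) {t c x a b : G} (hcc : c * c = 1) (hc1 : c ≠ 1)
    (hcen : ∀ g : G, c * g = g * c) (hxt : x * t * x⁻¹ = t * c)
    (hconj : ∀ g : G, g * t * g⁻¹ = t ∨ g * t * g⁻¹ = t * c) (htt : t * t = 1) (ht1 : t ≠ 1) (htne : t ≠ c)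
    (hat : a * t = t * a) (hbt : b * t = t * b) {α₁ α₂ : ZMod 2} (haa : a * a = t ^ α₁.val * c ^ α₂.val)
    (ha : ∀ p q : ZMod 2, a ≠ t ^ p.val * c ^ q.val) (hb : ∀ p q i : ZMod 2, b ≠ t ^ p.val * (c ^ q.val * a ^ i.val))
    (m : G) (hm : m * t = t * m) :
    ∃ p q i j : ZMod 2, m = t ^ p.val * c ^ q.val * a ^ i.val * b ^ j.val := by
  classical
  have hidx := index_centralizer_eq_two_of_conj hc1 hxt hconj
  obtain ⟨⟨p, q, i, j⟩, h⟩ := exists_eq_of_injective_sixteen hcard hidx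
    (by simp) _
    (words_injective_pair htt hcc (hcen t).symm ht1 htne hc1 hat (hcen a).symm haa ha hb)
    (fun P => Subgroup.mem_centralizer_singleton_iff.2
      ((((((Commute.refl t).pow_right _).mul_right ((show Commute t c from (hcen t).symm).pow_right _)).mul_right
        ((show Commute t a from hat.symm).pow_right _)).mul_right ((show Commute t b from hbt.symm).pow_right _)).eq).symm)
    m (Subgroup.mem_centralizer_singleton_iff.2 hm)
  exact ⟨p, q, i, j, h.symm⟩

end Summit.HodgeConjecture.CorCM.GaloisModels.CaseA
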